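import Summits.QuantumFields.YangMills.Theorems.ParabolicTrajectoryContinuumLimitOnTrajectoryDefsB
import Summits.QuantumFields.YangMills.Theorems.ParabolicTrajectoryLatticeGapOnTrajectoryTransferFromOSGap

/-!
# Route `ParabolicTrajectory`, crux `ContinuumLimitOnTrajectory` (stmt-QuantumFields-10522): vocabulary of line `two-orbit-synchronisation`, part C (reshape v3, seat c2)

Third route-posited vocabulary file of the line (lead `prover-line-stmt-QuantumFields-10522-c2-0`, third concurrent seat;
same namespace as `…Defs`/`…DefsB`). v2 of the skeleton left three open legs — `FiniteSizeLeg`, `UVRegularity`,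
`ClusteringLeg` — each a monolithic "input". v3 splits them into LATTICE KINEMATICS (provable over the tree: exact torus
reflection positivity, hypercubic symmetry and translation invariance of Wilson's torus measure, the OS-currency gap
machinery of crux (B)'s line) and RESIDUAL INPUTS in their sharpest form, and it threads a VOLUME-GROWTH clause that the
crux as typed lacks (torus-seam report `Cruxes/ContinuumLimitOnTrajectory/SEAM-two-orbit-synchronisation.md`: Schwartz
test functions sampled on `box 4 L_k` with the periodic lift make opposite faces torus-neighbours; canonical lattice
Schwinger functions on off-diagonal Schwartz tensors are seam-free for all test functions iff the physical volume grows at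
least like a power of `a_k⁻¹`). NOTHING here is asserted except §5 (elementary glue, proved):
* §1 `PolyVolumeGrowth sch` — `∃ N ≥ 1, ∀ᶠ k, a_k⁻¹ ≤ (a_k L_k)^N`.
* §2 `plaq r q` (the six single-plaquette species), `canonDistribution r sch k p σ F` (canonical = unit-weight, torus-mean-centred
  lattice distribution of a species STRING on a complex test function; on the constant string `r.curvature` it is
  `curvDistribution`, §5), `UUVB r sch` (UNIFORM-threshold E0'-type bounds for all plaquette strings: the form of `UVB` that
  reaches `k`-dependent test functions — difference quotients, lattice roundings — and mixed strings).
* §3 `AsympTransl`, `AsympRot` (the two halves of `AsympEuclid`, §5 `asympEuclid_iff`), `AxisSymm r sch` (exact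
  invariance of the canonical curvature distributions under permutations of the four lattice axes), `QualFiniteSize`
  (the qualitative finite-size clause = verbatim the conclusion of `volumeIndependence_of_scaledFiniteSize`; the exponential
  rate of `ScaledFiniteSize` is untenable for sub-exponentially decaying Schwartz functions, seam report §4).
* §4 the v3 stub statements: inputs `IRInputs` (PolyVolumeGrowth ∧ QualFiniteSize ∧ a torus OS gap `TorusOSGap r sch Δ'`,
  crux (B)'s currency — the FIRST conjunct is the quarantined volume clause: unprovable from the crux hypotheses as typed,
  `id` once the planner adds it to (A)), `UVInputs` (UUVB ∧ UVB ∧ AsympRot ∧ ND2 ∧ ND3); provable `ARPOfUUVB`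
  (approximate RP of the time-chiral corner density from exact site RP + UUVB), `TranslOfUUVB` (translation half of E1
  from torus translations + UUVB + volume growth), `AxisSymmetry`, `UCLOfGap` (`UCL` from `TorusOSGap` + axis symmetry +
  UUVB + volume growth: (A)'s E4 debt and (B)'s transfer clause are fed by ONE statement).
* §5 glue: `canonDistribution_curvature`, `asympEuclid_iff`.
Refs: line card `Lines/two-orbit-synchronisation.md`; OsterwalderSeiler1978 §2; OsterwalderSchrader1975 §2; GlimmJaffe1987
§6.1, §19.7; the seam report; `…LatticeGapOnTrajectoryTransferFromOSGap` (`TorusOSGap`).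
-/

set_option autoImplicit false

open scoped SchwartzMap
open MeasureTheory Filter Topology
open Literature.MathematicalPhysics.QuantumFieldTheory Literature.MathematicalPhysics.QuantumLattice
open Literature.MathematicalPhysics.AQFT Literature.Probability.LatticeModels
open Summit.QuantumFields.YangMills.Theses.ParabolicTrajectory
open Summit.QuantumFields.YangMills.Cruxes.LatticeGapOnTrajectory.OrbitKantorovichFiniteSize.Transfer (TorusOSGap)

noncomputable section

namespace Summit.QuantumFields.YangMills.Cruxes.ContinuumLimitOnTrajectory.TwoOrbitSynchronisation

local notation "𝔼" => EuclideanSpace ℝ (Fin 4)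

/-! ## §1 Volume growth -/

/-- **Polynomial volume growth** of a scheme: the physical torus half-side `a_k L_k` dominates a POWER of the inverse
spacing, `a_k⁻¹ ≤ (a_k L_k)^N` eventually (equivalently `liminf log(a_k L_k)/log a_k⁻¹ > 0`). The clause the crux (A)
as typed lacks (its only volume clause is `a_k L_k → ∞`): exactly the condition under which Schwartz tails wrapped around
the torus seam are negligible against the `a_k⁻³` face multiplicity (seam report §3). -/
def PolyVolumeGrowth {ι : Type} (sch : SpeciesScheme ι) : Prop :=
  ∃ N : ℕ, 1 ≤ N ∧ ∀ᶠ k in atTop, (sch.a k)⁻¹ ≤ (sch.a k * (sch.L k : ℝ)) ^ N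

/-! ## §2 Plaquette species, canonical distributions of species strings, uniform UV bounds -/

/-- Index of the six plaquette orientations `(μ, ν)`, `μ < ν`. -/
abbrev PlaqIdx : Type := {q : Fin 4 × Fin 4 // q.1 < q.2}

section Species

variable {G : Type} [Group G] [TopologicalSpace G] [IsTopologicalGroup G] [CompactSpace G]
  [MeasurableSpace G] [BorelSpace G]

/-- **The single-plaquette species** `Re tr r.ρ(U_p)`, `p` the plaquette at the origin in the `(q.1, q.2)` plane, as a
gauge-invariant local lattice observable (tree `plaquetteObservable`; second countability of `G` from the closed embedding
`r.ρ`, as for `LatticeRep.curvature`). The curvature species is their sum: `r.curvature.F = ∑_{μ<ν} (plaq r ⟨(μ,ν),_⟩).F`. -/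
def plaq (r : LatticeRep G) (q : PlaqIdx) : YMSpecies G :=
  haveI : SecondCountableTopology G :=
    (r.continuous.isClosedEmbedding r.injective).isEmbedding.secondCountableTopology
  plaquetteObservable r.ρ r.continuous q.1.1 q.1.2

/-- **Canonical lattice distribution of a species string** `σ` at step `k` on a complex `p`-point test function:
`∫ ∑ₓ F(a_k x⃗) ∏ᵢ (σᵢ(τ_{xᵢ}Ũ) − ⟨σᵢ⟩_k) dμ_k` — unit weight (the canonical `c a⁴ = a⁻⁴ a⁴ = 1`), exact centring by the
torus Wilson mean, torus `2L_k+1`, box representatives. On the constant string `r.curvature` it is `curvDistribution`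
(`canonDistribution_curvature`). -/
def canonDistribution (r : LatticeRep G) (sch : SpeciesScheme (YMSpecies G)) (k p : ℕ) (σ : Fin p → YMSpecies G)
    (F : 𝓢((Fin p → 𝔼), ℂ)) : ℂ :=
  ∫ U, ∑ x : Fin p → ↥(box 4 (sch.L k)), F (fun i => sch.a k • siteToE (↑(x i) : Site 4)) *
      ∏ i, (((σ i).F (configShift (-(↑(x i) : Site 4)) (torusLift (sch.side k) U)) -
          wilsonTorusMean r.ρ (sch.β k) (sch.L k) (σ i).F : ℝ) : ℂ)
    ∂(wilsonMeasure (d := 4) (L := sch.side k) r.ρ (sch.β k))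

/-- **(UUVB) uniform-threshold E0'-type bounds for all plaquette strings.** One Schwartz index `s`, constants `α, β` and
ONE threshold in `k` beyond which, for every arity `p`, every string of single-plaquette species and every off-diagonal
test function, `‖canonDistribution k σ F‖ ≤ α (p!)^β |F|_{p s}`. Strengthens `UVB` in two ways that the lattice-kinematics
theorems need: the threshold does not depend on `F` (difference quotients and lattice roundings are `k`-dependent test
functions) and mixed plaquette strings are covered (the corner density is time-chiral: its reflection is a sum of
translated plaquettes). `UVB` follows by multilinearity (`6^p ≤ 65·p!`). -/
def UUVB (r : LatticeRep G) (sch : SpeciesScheme (YMSpecies G)) : Prop :=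
  ∃ (s : ℕ) (α β : ℝ), ∀ᶠ k in atTop, ∀ (p : ℕ) (q : Fin p → PlaqIdx) (F : 𝓢((Fin p → 𝔼), ℂ)), IsOffDiagonal F →
    ‖canonDistribution r sch k p (fun i => plaq r (q i)) F‖ ≤ α * (p.factorial : ℝ) ^ β * schwartzNorm (p * s) F

/-! ## §3 Halves of E1, axis symmetry, the qualitative finite-size clause -/

/-- **Translation half of `AsympEuclid`**: translating an off-diagonal test function changes the canonical curvature
distributions by `o(1)`. (Provable: exact torus translations + `UUVB` on the sub-lattice remainder + volume growth for
the seam relocation — `TranslOfUUVB`.) -/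
def AsympTransl (r : LatticeRep G) (sch : SpeciesScheme (YMSpecies G)) : Prop :=
  ∀ (p : ℕ) (F : 𝓢((Fin p → 𝔼), ℂ)), IsOffDiagonal F → ∀ a : 𝔼,
    Tendsto (fun k => curvDistribution r sch k p (translateMulti a F) - curvDistribution r sch k p F) atTop (𝓝 0)

/-- **Rotation half of `AsympEuclid`** (the conceded E1 burden, `RegularisationDichotomy` evasion (b)): proper rotations
change the canonical curvature distributions by `o(1)`. -/
def AsympRot (r : LatticeRep G) (sch : SpeciesScheme (YMSpecies G)) : Prop :=
  ∀ (p : ℕ) (F : 𝓢((Fin p → 𝔼), ℂ)), IsOffDiagonal F → ∀ R : 𝔼 ≃ₗᵢ[ℝ] 𝔼,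
    LinearMap.det (R.toLinearEquiv : 𝔼 →ₗ[ℝ] 𝔼) = 1 →
      Tendsto (fun k => curvDistribution r sch k p (linActMulti R F) - curvDistribution r sch k p F) atTop (𝓝 0)

/-- **Exact axis symmetry** of the canonical curvature distributions of one scheme: permuting the four coordinate axes of
all points of a test function (the linear isometry `piLpCongrLeft 2 ℝ ℝ σ`, `(Rx)_j = x_{σ⁻¹ j}`) leaves every
`curvDistribution r sch k p` unchanged — Wilson's action, product Haar measure, the corner density `∑_{μ<ν} Re tr U_{μν}`
(for unitary `r.ρ`, `Re tr U_{νμ} = Re tr U_{μν}⁻¹ = Re tr U_{μν}`) and the cube `box 4 L_k` are all invariant. -/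
def AxisSymm (r : LatticeRep G) (sch : SpeciesScheme (YMSpecies G)) : Prop :=
  ∀ (k p : ℕ) (σ : Equiv.Perm (Fin 4)) (F : 𝓢((Fin p → 𝔼), ℂ)),
    curvDistribution r sch k p (linActMulti (LinearIsometryEquiv.piLpCongrLeft 2 ℝ ℝ σ) F) =
      curvDistribution r sch k p F

/-- **Qualitative finite-size clause** along an `M`-adic scheme (verbatim the conclusion of
`volumeIndependence_of_scaledFiniteSize`, i.e. what the composition consumes): (a) canonical curvature `p`-point functions on
the scheme's torus agree up to `o(1)`, uniformly over all larger tori, with the unit-normalised centred Wilson functions with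
block-dilated test functions; (b) the same for the scaled point-split correlators. -/
def QualFiniteSize (r : LatticeRep G) (M : ℕ) (sch : SpeciesScheme (YMSpecies G)) (n : ℕ → ℕ) : Prop :=
  (∀ (p : ℕ) (f : Fin p → 𝓢(𝔼, ℝ)), IsOffDiagonal (SchwartzMap.tensorFin p fun i => ofRealTest (f i)) →
      ∀ ε : ℝ, 0 < ε → ∀ᶠ k in atTop, ∀ L : ℕ, sch.L k ≤ L →
        |curvNPoint r sch k p f -
            wilsonCentredSchwinger r.ρ (sch.β k) L (fun _ => 1) p (fun _ => r.curvature)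
              (fun i => (blockDilate M)^[n k] (f i))| ≤ ε) ∧
    (∀ t : ℕ, 0 < t → ∀ ε : ℝ, 0 < ε → ∀ᶠ k in atTop, ∀ S : ℕ, sch.L k ≤ S →
      ((M : ℝ) ^ n k) ^ 8 *
        |latticeConnectedCorr r.ρ (sch.β k) (sch.side k) r.curvature.F r.curvature.F (t * M ^ n k) -
          latticeConnectedCorr r.ρ (sch.β k) (2 * S + 1) r.curvature.F r.curvature.F (t * M ^ n k)| ≤ ε)

end Species

/-! ## §4 The v3 stub statements -/

/-- **Stub statement — IR INPUTS (open; the first conjunct is the QUARANTINED volume clause).** Along every sequence of the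
crux's hypothesis block: (1) `PolyVolumeGrowth sch` — NOT derivable from the block as typed (the block admits arbitrarily
slow volume growth, under which (A)'s conclusion fails for the kinematic seam reason): this conjunct is the one place the
misstatement lives and becomes `id` once (A) carries the clause; (2) `QualFiniteSize` — the rate-free thermodynamic-limit
statement at scale (IR physics); (3) a torus OS gap `TorusOSGap r sch Δ'` for some `Δ' > 0` — crux (B)'s OS-currency gap on
the scheme's own torus (IR physics; the same statement feeds (B)'s transfer clause, `transferHalf_of_torusOSGap`). -/
def IRInputs : Prop :=
  ∀ (G : Type) [Group G] [TopologicalSpace G] [IsTopologicalGroup G] [CompactSpace G]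
    [MeasurableSpace G] [BorelSpace G], IsCompactSimpleLieGroup G →
    ∀ (r : LatticeRep G) (M : ℕ) (θ Δ : ℝ) (sch : SpeciesScheme (YMSpecies G)) (n : ℕ → ℕ),
    0 < θ → 0 < Δ → (∀ k, sch.a k = ((M : ℝ) ^ n k)⁻¹) → Tendsto sch.β atTop atTop →
    (∀ t : ℕ, 0 < t → ∃ c : ℝ, Tendsto (fun k => ((M : ℝ) ^ n k) ^ 8 *
      latticeConnectedCorr r.ρ (sch.β k) (sch.side k) r.curvature.F r.curvature.F (t * M ^ n k))
        atTop (𝓝 c)) →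
    Tendsto (fun k => ((M : ℝ) ^ n k) ^ 8 *
      latticeConnectedCorr r.ρ (sch.β k) (sch.side k) r.curvature.F r.curvature.F (M ^ n k))
        atTop (𝓝 θ) →
    HasLatticeMassGap r sch Δ →
      PolyVolumeGrowth sch ∧ QualFiniteSize r M sch n ∧ ∃ Δ' : ℝ, 0 < Δ' ∧ TorusOSGap r sch Δ'

/-- **Stub statement — UV INPUTS (open).** Along a crux-admissible sequence with polynomial volume growth whose canonical
curvature functions converge on products: uniform-threshold plaquette-string bounds `UUVB` (and its consequence `UVB`, kept
as a conjunct until the multilinearity glue lands), rotation restoration `AsympRot`, and the two non-degeneracy witnesses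
`ND2`, `ND3`. (`ARP` and the translation half of E1 are no longer inputs: `ARPOfUUVB`, `TranslOfUUVB`.) -/
def UVInputs : Prop :=
  ∀ (G : Type) [Group G] [TopologicalSpace G] [IsTopologicalGroup G] [CompactSpace G]
    [MeasurableSpace G] [BorelSpace G], IsCompactSimpleLieGroup G →
    ∀ (r : LatticeRep G) (M : ℕ) (θ Δ : ℝ) (sch : SpeciesScheme (YMSpecies G)) (n : ℕ → ℕ),
    0 < θ → 0 < Δ → (∀ k, sch.a k = ((M : ℝ) ^ n k)⁻¹) → Tendsto sch.β atTop atTop →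
    (∀ t : ℕ, 0 < t → ∃ c : ℝ, Tendsto (fun k => ((M : ℝ) ^ n k) ^ 8 *
      latticeConnectedCorr r.ρ (sch.β k) (sch.side k) r.curvature.F r.curvature.F (t * M ^ n k))
        atTop (𝓝 c)) →
    Tendsto (fun k => ((M : ℝ) ^ n k) ^ 8 *
      latticeConnectedCorr r.ρ (sch.β k) (sch.side k) r.curvature.F r.curvature.F (M ^ n k))
        atTop (𝓝 θ) →
    HasLatticeMassGap r sch Δ → PolyVolumeGrowth sch → ConvProducts r sch →
      UUVB r sch ∧ UVB r sch ∧ AsympRot r sch ∧ ND2 r sch ∧ ND3 r sch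

/-- **Stub statement — approximate RP from uniform UV bounds (PROVABLE lattice kinematics).** For time-ordered `F_j` the Gram
sum `∑ᵢⱼ curvDistribution (ΘFᵢ* ⊗ Fⱼ)` equals `∫ (∑ᵢ Φ(ΘFᵢ*)) (∑ⱼ Φ(Fⱼ)) dμ_k`; exact site reflection positivity of Wilson's
torus measure (`Θ' = negReflect`) makes `∫ conj(A∘Θ')·A ≥ 0` for the positive-time observable `A = ∑ⱼ Φ(Fⱼ)` (after a
`k`-independent time truncation, error by `UUVB`), and `A∘Θ'` differs from `∑ᵢ Φ(ΘFᵢ*)` only through the time-chirality of the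
corner density, `P∘Θ' − P∘τ = E − τ_{−e₀}E` (electric part), i.e. by smeared ELECTRIC plaquette strings against difference
quotients `g − g(· + a_k e₀) = O(a_k)` in Schwartz norm — `o(1)` by `UUVB` (uniform threshold, mixed strings). -/
def ARPOfUUVB : Prop :=
  ∀ (G : Type) [Group G] [TopologicalSpace G] [IsTopologicalGroup G] [CompactSpace G]
    [MeasurableSpace G] [BorelSpace G] (r : LatticeRep G) (sch : SpeciesScheme (YMSpecies G)),
    UUVB r sch → ARP r sch

/-- **Stub statement — translation half of E1 from uniform UV bounds (PROVABLE lattice kinematics).** Split `a ∈ ℝ⁴` into a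
lattice vector `a_k v_k` and a remainder `|r_k| ≤ a_k`: exact invariance of the torus Wilson state under lattice translations
(up to the relocation of the box seam, `o(1)` under `PolyVolumeGrowth` by Schwartz decay against `a_k^{-4p}` face multiplicity)
and `UUVB` on `T_{r_k}F − F → 0` in `𝒮`. -/
def TranslOfUUVB : Prop :=
  ∀ (G : Type) [Group G] [TopologicalSpace G] [IsTopologicalGroup G] [CompactSpace G]
    [MeasurableSpace G] [BorelSpace G] (r : LatticeRep G) (sch : SpeciesScheme (YMSpecies G)),
    PolyVolumeGrowth sch → UUVB r sch → AsympTransl r sch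

/-- **Stub statement — exact axis symmetry (PROVABLE lattice kinematics)**: `AxisSymm r sch` for every `r, sch`. -/
def AxisSymmetry : Prop :=
  ∀ (G : Type) [Group G] [TopologicalSpace G] [IsTopologicalGroup G] [CompactSpace G]
    [MeasurableSpace G] [BorelSpace G] (r : LatticeRep G) (sch : SpeciesScheme (YMSpecies G)), AxisSymm r sch

/-- **Stub statement — uniform spatial clustering from a torus OS gap (PROVABLE given the inputs).** `UCL r sch` (the E4
input of the packaging: `k`-uniform qualitative clustering of the canonical curvature distributions under spatial
translations of time-ordered test functions) from: a torus OS gap `TorusOSGap r sch Δ'` (`Δ' > 0`, time axis, crux (B)'s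
currency), exact axis symmetry (turn the dominant spatial component of the translation into the time axis), `UUVB` (Schwartz
cutoffs at the separating hyperplane, sub-lattice roundings, OS variances of the slab-localised pieces) and `PolyVolumeGrowth`
(seam relocations). The gap's exponential beats the polynomial growth of the weighted Schwartz norms of the translated
factor, so the bound is uniform in the translation for `t ≥ t₀`. -/
def UCLOfGap : Prop :=
  ∀ (G : Type) [Group G] [TopologicalSpace G] [IsTopologicalGroup G] [CompactSpace G]
    [MeasurableSpace G] [BorelSpace G] (r : LatticeRep G) (sch : SpeciesScheme (YMSpecies G)),
    AxisSymm r sch → PolyVolumeGrowth sch → UUVB r sch → ∀ Δ' : ℝ, 0 < Δ' → TorusOSGap r sch Δ' → UCL r sch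

/-! ## §5 Glue (proved) -/

/-- On the constant curvature string the canonical string distribution IS `curvDistribution` (the literal weight
`(a⁴)⁻¹ a⁴` of `curvDistribution` is `1`). -/
theorem canonDistribution_curvature :
    ∀ {G : Type} [Group G] [TopologicalSpace G] [IsTopologicalGroup G] [CompactSpace G]
      [MeasurableSpace G] [BorelSpace G] (r : LatticeRep G) (sch : SpeciesScheme (YMSpecies G)) (k p : ℕ)
      (F : 𝓢((Fin p → EuclideanSpace ℝ (Fin 4)), ℂ)),
      canonDistribution r sch k p (fun _ => r.curvature) F = curvDistribution r sch k p F := by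
  intro G _ _ _ _ _ _ r sch k p F
  have ha : ((sch.a k) ^ 4)⁻¹ * sch.a k ^ 4 = 1 := inv_mul_cancel₀ (pow_ne_zero 4 (sch.a_pos k).ne')
  unfold canonDistribution curvDistribution
  simp only [ha, one_mul]

section Glue

variable {G : Type} [Group G] [TopologicalSpace G] [IsTopologicalGroup G] [CompactSpace G]
  [MeasurableSpace G] [BorelSpace G]

/-- `AsympEuclid` is the conjunction of its translation and rotation halves. -/
theorem asympEuclid_iff (r : LatticeRep G) (sch : SpeciesScheme (YMSpecies G)) :
    AsympEuclid r sch ↔ AsympTransl r sch ∧ AsympRot r sch := Iff.rfl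

end Glue

/-! ## §6 (append, v3.1) Reflection positivity of slab observables as a named input

Both reflection-positivity theorems of the tree (`WilsonSiteRP.*`, `wilsonExpectation_reflectionPositive`) require an EVEN
torus side, while `SpeciesScheme.side = 2L+1` is odd (the site reflection `t ↦ −t` then fixes the site plane `t = 0` AND the
link plane at the antipode — a mixed reflection whose positivity is not in the tree). The `m = 0` case of crux (B)'s
`TorusOSGap` IS that positivity for slab observables (`‖z‖ ≤ z.re` forces `z` real non-negative), so v3.1 names it
(`TorusSlabRP`), derives it from `TorusOSGap` (`torusSlabRP_of_torusOSGap`, proved) and lets the approximate-RP stub consume it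
(`ARPOfRP`, replacing `ARPOfUUVB` in the composition; an unconditional proof of `TorusSlabRP` — mixed site/link RP on odd
tori, Osterwalder–Seiler 1978 §2 — would make it hypothesis-free). -/

section SlabRP

open scoped ComplexConjugate

variable {G : Type} [Group G] [TopologicalSpace G] [IsTopologicalGroup G] [CompactSpace G]
  [MeasurableSpace G] [BorelSpace G]

/-- **Reflection positivity of slab observables on the scheme's tori** (a named INPUT here; the `m = 0` case of
`TorusOSGap`): eventually in `k`, for every bounded measurable `X` on the configurations of the torus of side `2L_k+1`
depending only on the links based at lattice times `1, …, w` with `2w ≤ L_k`, the OS pairing `∫ conj X(Θ'U) · X(U) dμ_k`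
(`Θ' = negReflect`, `μ_k` Wilson's measure at `β_k`) is real and non-negative. -/
def TorusSlabRP (r : LatticeRep G) (sch : SpeciesScheme (YMSpecies G)) : Prop :=
  ∃ k₀ : ℕ, ∀ k ≥ k₀, ∀ (w : ℕ) (X : GaugeConfig 4 (sch.side k) G → ℂ), Measurable X →
    (∃ B, ∀ U, ‖X U‖ ≤ B) →
    DependsOn X {e : Edge 4 (sch.side k) | 1 ≤ (e.1 0).val ∧ (e.1 0).val ≤ w} →
    2 * w ≤ sch.L k →
      0 ≤ (∫ U, conj (X U.negReflect) * X U ∂(wilsonMeasure r.ρ (sch.β k))).re ∧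
        (∫ U, conj (X U.negReflect) * X U ∂(wilsonMeasure r.ρ (sch.β k))).im = 0

/-- A complex number dominated in norm by its own real part is real and non-negative. -/
theorem re_nonneg_and_im_eq_zero_of_norm_le_re {z : ℂ} (h : ‖z‖ ≤ z.re) : 0 ≤ z.re ∧ z.im = 0 := by
  have h0 : 0 ≤ z.re := (norm_nonneg z).trans h
  refine ⟨h0, ?_⟩
  have h1 : z.re ^ 2 + z.im ^ 2 ≤ z.re ^ 2 := by
    have h2 : ‖z‖ ^ 2 ≤ z.re ^ 2 := pow_le_pow_left₀ (norm_nonneg z) h 2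
    have h3 : ‖z‖ ^ 2 = z.re ^ 2 + z.im ^ 2 := by
      rw [Complex.sq_norm, Complex.normSq_apply]; ring
    linarith
  have h4 : z.im ^ 2 ≤ 0 := by linarith
  exact pow_eq_zero_iff (n := 2) (by norm_num) |>.1 (le_antisymm h4 (sq_nonneg _))

end SlabRP

/-- **`TorusOSGap` at `m = 0` is reflection positivity of slab observables** (registered glue of skeleton v3.1): the bound
`‖∫ conj X(Θ'U) X(τ₀U) − |∫X|²‖ ≤ Re(…) · e⁰` forces the OS variance to be real non-negative, and adding back `|∫X|²` gives
the OS pairing itself. -/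
theorem torusSlabRP_of_torusOSGap :
    ∀ {G : Type} [Group G] [TopologicalSpace G] [IsTopologicalGroup G] [CompactSpace G]
      [MeasurableSpace G] [BorelSpace G] (r : LatticeRep G) (sch : SpeciesScheme (YMSpecies G)) (Δ : ℝ),
      TorusOSGap r sch Δ → TorusSlabRP r sch := by
  intro G _ _ _ _ _ _ r sch Δ h
  obtain ⟨k₀, hk₀⟩ := h
  refine ⟨k₀, fun k hk w X hXm hXb hXd hw => ?_⟩
  have h0 := hk₀ k hk w 0 X hXm hXb hXd (by omega)
  simp only [Summit.QuantumFields.YangMills.Cruxes.LatticeGapOnTrajectory.OrbitKantorovichFiniteSize.Transfer.coe_torusTimeShift_zero,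
    id, Nat.cast_zero, mul_zero, Real.exp_zero, mul_one] at h0
  set z : ℂ := ∫ U, (starRingEnd ℂ) (X U.negReflect) * X U ∂(wilsonMeasure r.ρ (sch.β k)) with hz
  set c : ℂ := ∫ U, X U ∂(wilsonMeasure r.ρ (sch.β k)) with hc
  have h1 : 0 ≤ (z - (starRingEnd ℂ) c * c).re ∧ (z - (starRingEnd ℂ) c * c).im = 0 :=
    re_nonneg_and_im_eq_zero_of_norm_le_re h0
  have hcc_re : ((starRingEnd ℂ) c * c).re = ‖c‖ ^ 2 := by
    rw [Complex.conj_mul', ← Complex.ofReal_pow, Complex.ofReal_re]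
  have hcc_im : ((starRingEnd ℂ) c * c).im = 0 := by
    rw [Complex.conj_mul', ← Complex.ofReal_pow, Complex.ofReal_im]
  rw [Complex.sub_re, hcc_re] at h1
  rw [Complex.sub_im, hcc_im, sub_zero] at h1
  exact ⟨by nlinarith [h1.1, sq_nonneg ‖c‖], h1.2⟩

/-- **Stub statement (v3.1) — approximate RP from slab RP + uniform UV bounds (PROVABLE lattice kinematics).** As
`ARPOfUUVB`, with the positivity supplied by the named input `TorusSlabRP` (fed by `TorusOSGap` via
`torusSlabRP_of_torusOSGap`) and `UVB` available for the `k`-independent time truncations: for time-ordered `F_j` the Gram sum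
`∑ᵢⱼ curvDistribution (ΘFᵢ* ⊗ Fⱼ)` is `∫ B · A dμ_k` with `A = ∑ⱼ Φ(Fⱼ)` positive-time, `B = ∑ᵢ Φ(ΘFᵢ*)`; `conj(A ∘ Θ')` is
`∑ᵢ Φ^{Θ r.curvature}(ΘFᵢ*)` (`smearedLatticeField_thetaTest`, species `timeReflect`), which differs from `B` by electric
plaquette strings against `O(a_k)` difference quotients (`UUVB`), and `∫ conj(A∘Θ') A ≥ 0` is `TorusSlabRP` after a
`k`-independent time truncation of the `F_j` (tails by `UVB`/`UUVB`). -/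
def ARPOfRP : Prop :=
  ∀ (G : Type) [Group G] [TopologicalSpace G] [IsTopologicalGroup G] [CompactSpace G]
    [MeasurableSpace G] [BorelSpace G] (r : LatticeRep G) (sch : SpeciesScheme (YMSpecies G)),
    TorusSlabRP r sch → UUVB r sch → UVB r sch → ARP r sch

end Summit.QuantumFields.YangMills.Cruxes.ContinuumLimitOnTrajectory.TwoOrbitSynchronisation

end
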